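import Mathlib
import Summits.Ventures.HodgeRepro2.T5ProfiniteCharacterExtension

/-!
# The unit group of the integers of a local field is profinite; (A8b) for it
(kernel witness for the dictionary step «the local-field groups in play are profinite» behind the
standard fact (A8b) of the Tier-5 [A]-ledger)

`T5ProfiniteCharacterExtension` proves (A8b) for compact totally disconnected abelian groups.
Here `K` is a complete non-archimedean (ultrametric) nontrivially normed field whose valuation ring
`𝒪[K]` is a discrete valuation ring with finite residue field `𝓀[K]` — Mathlib's description of
a non-archimedean local field (`E_v`, `F_v` of the cell) — and we show:

* `completeSpace_integer`, `compactSpace_integer` — `𝒪[K]` is complete and compact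
  (Mathlib: `compactSpace_iff_completeSpace_and_isDiscreteValuationRing_and_finite_residueField`);
* `range_val_eq`, `isClosed_range_val` — the units of `𝒪[K]` are the elements of norm `1`, a
  closed subset;
* `compactSpace_units`, `totallyDisconnectedSpace_units` — **`𝒪[K]ˣ` is compact and totally
  disconnected** (the coercion `𝒪[K]ˣ → 𝒪[K]` is an embedding with closed range);
* `exists_continuous_extension_circle` — **(A8b) for `𝒪[K]ˣ`**: every continuous unitary character
  of ANY subgroup `H ≤ 𝒪[K]ˣ` (e.g. the norm-one group `E¹_v` inside `𝒪_{E_v}^×`, or the units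
  of a subfield) extends to a continuous unitary character of `𝒪[K]ˣ`; primed form: with an
  open subgroup in the kernel of the extension.

Not modelled: `E_v^×` itself (non-compact; the ledger's uses of (A8b) are on compact groups).
Imports: Mathlib + one accepted file of this prefix; axioms standard.
Uses an L-value-free non-vanishing device: NO (README §8(d)).
-/

namespace Summit.Ventures.HodgeRepro2.T5LocalUnitsProfinite

open scoped NormedField Valued
open Summit.Ventures.HodgeRepro2.T5ProfiniteCharacterExtension

variable {K : Type*} [NontriviallyNormedField K] [IsUltrametricDist K]

/-- The valuation of record is `NormedField.valuation`, of rank one (re-registered for `Valued.v`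
so that Mathlib's compactness criterion applies verbatim). -/
noncomputable instance rankOne_v : (Valued.v : Valuation K NNReal).RankOne :=
  inferInstanceAs (Valuation.RankOne (NormedField.valuation (K := K)))

/-- The valuation ring of a complete ultrametric field is complete (a closed subset). -/
instance completeSpace_integer [CompleteSpace K] : CompleteSpace 𝒪[K] :=
  (Valued.isClosed_integer (R := K)).completeSpace_coe

/-- The valuation ring of a complete ultrametric field with discrete valuation and finite residue
field is compact. -/
theorem compactSpace_integer [CompleteSpace K] [IsDiscreteValuationRing 𝒪[K]] [Finite 𝓀[K]] :
    CompactSpace 𝒪[K] :=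
  Valued.integer.compactSpace_iff_completeSpace_and_isDiscreteValuationRing_and_finite_residueField
    |>.mpr ⟨inferInstance, inferInstance, inferInstance⟩

/-- The units of `𝒪[K]` are exactly the elements of norm `1`. -/
theorem range_val_eq : Set.range (Units.val : 𝒪[K]ˣ → 𝒪[K]) = {x | ‖x‖ = 1} := by
  ext x
  constructor
  · rintro ⟨u, rfl⟩
    exact Valued.integer.norm_unit u
  · intro hx
    exact Valued.integer.isUnit_iff_norm_eq_one.mpr hx

/-- The set of units of `𝒪[K]` is closed. -/
theorem isClosed_range_val : IsClosed (Set.range (Units.val : 𝒪[K]ˣ → 𝒪[K])) := by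
  rw [range_val_eq]
  exact isClosed_eq continuous_norm continuous_const

/-- The coercion `𝒪[K]ˣ → 𝒪[K]` is a topological embedding (`𝒪[K]` is a complete normed ring). -/
theorem isEmbedding_val [CompleteSpace K] :
    Topology.IsEmbedding (Units.val : 𝒪[K]ˣ → 𝒪[K]) :=
  Units.isOpenEmbedding_val.isEmbedding

/-- **`𝒪[K]ˣ` is compact.** -/
theorem compactSpace_units [CompleteSpace K] [IsDiscreteValuationRing 𝒪[K]] [Finite 𝓀[K]] :
    CompactSpace 𝒪[K]ˣ := by
  haveI := compactSpace_integer (K := K)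
  rw [← isCompact_univ_iff, isEmbedding_val.isCompact_iff, Set.image_univ]
  exact isClosed_range_val.isCompact

/-- **`𝒪[K]ˣ` is totally disconnected** (`𝒪[K]` is ultrametric). -/
theorem totallyDisconnectedSpace_units [CompleteSpace K] : TotallyDisconnectedSpace 𝒪[K]ˣ :=
  isEmbedding_val.isTotallyDisconnected_range.mp
    (isTotallyDisconnected_of_totallyDisconnectedSpace _)

/-- **(A8b) for the unit group of a local field.** Every continuous unitary character of ANY
subgroup `H ≤ 𝒪[K]ˣ` extends to a continuous unitary character of `𝒪[K]ˣ`. -/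
theorem exists_continuous_extension_circle [CompleteSpace K] [IsDiscreteValuationRing 𝒪[K]]
    [Finite 𝓀[K]] (H : Subgroup 𝒪[K]ˣ) (χ : H →* Circle) (hχ : Continuous χ) :
    ∃ χ' : 𝒪[K]ˣ →* Circle, Continuous χ' ∧ ∀ h : H, χ' h = χ h := by
  haveI := compactSpace_units (K := K)
  haveI := totallyDisconnectedSpace_units (K := K)
  exact exists_continuous_extension_circle_of_profinite H χ hχ

/-- The primed form: the extension may be chosen trivial on an open subgroup of `𝒪[K]ˣ`
(so it factors through a finite quotient — «finite conductor»). -/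
theorem exists_continuous_extension_circle' [CompleteSpace K] [IsDiscreteValuationRing 𝒪[K]]
    [Finite 𝓀[K]] (H : Subgroup 𝒪[K]ˣ) (χ : H →* Circle) (hχ : Continuous χ) :
    ∃ χ' : 𝒪[K]ˣ →* Circle, Continuous χ' ∧ (∀ h : H, χ' h = χ h) ∧
      ∃ U : Subgroup 𝒪[K]ˣ, IsOpen (U : Set 𝒪[K]ˣ) ∧ ∀ u ∈ U, χ' u = 1 := by
  haveI := compactSpace_units (K := K)
  haveI := totallyDisconnectedSpace_units (K := K)
  exact exists_continuous_extension_circle_of_profinite' H χ hχ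

end Summit.Ventures.HodgeRepro2.T5LocalUnitsProfinite
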